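import Summits.ResolutionOfSingularities.ResolutionOfSingularities.Theorems.WildConesCampaignW46HypersurfacesCharTwoSatelliteUnique
import Mathlib.FieldTheory.Perfect

/-!
# [OURS · L1 W4.6, rung (ii) at p = 2, EVERY dimension n] THE SATELLITE EXISTS AT `h₂ = 2` OVER A PERFECT
# FIELD: a corank-two double point of the multiple-tangent class `(e, h₂) = (2, 2)` has EXACTLY ONE
# infinitely-near double point whose successor has corank two again — the corank-two chain is
# DETERMINISTIC there — `z² = a(u₁,…,uₙ)` over every perfect field of characteristic 2

HONEST FRAMING. Everything here is OURS: theorems about route WildCones' own TYPED point-blow-up dynamics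
(`Theorems/WildConesClassicalRegimesDefs.lean`) and the seat's invariants `polarMatrix` (p502936),
`milnorEmbDim` (p498937), `milnorHilbertTwo` (p511581), `degForm` (p522667). NOTHING here is a statement
of the manuscript [Hironaka2017]; no FACT-LIST premise; AI review is weaker than expert review. Cell
res-hironaka (LADDER-RESOLUTION rung L, D-0089), slot W4.6, seat res-L1-s46-pv-4 (gen 5); host route
`WildCones`, crux `ClassicalRegimes` (stmt-ResolutionOfSingularities-16884; proved).

THE ARGUMENT. (1) `hypersurface_exists_null_polar_of_two_le_milnorHilbertTwo`: if `h₂ ≥ 2` then some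
non-zero kernel vector `λ₀` has IDENTICALLY VANISHING polar `v ↦ Σ λ₀ₛ (∂ₛa)₂(v)` on the kernel. For if
the polar map were injective on the kernel `K = ⟨k₁, k₂⟩`, the directional derivatives `D_{k₁}a, D_{k₂}a`,
written `≡ αᵢx² + βᵢxy + γᵢy²` modulo `𝔪(∂a) + 𝔪³` (p529758), would give two INDEPENDENT relations among
the classes `[x²], [xy], [y²]` of `κ⟦u⟧/((∂a)+𝔪³)`, so the six classes span a space of dimension `≤ 4`,
i.e. `h₂ + 3 ≤ 4`. (2) `hypersurface_exists_satellite_of_milnorHilbertTwo_eq_two` (PERFECT field): with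
`K = ⟨λ₀, μ⟩`, the quadratic form `q(v) = Σ μₛ (∂ₛa)₂(v)` is ADDITIVE on `K` (its cross term is the
trilinear form of p536239, which vanishes on `K³` in characteristic two), so with square roots
`p'² = q(λ₀)`, `r'² = q(μ)` the vector `w₀ = r'λ₀ + p'μ` has `q(w₀) = r p + p r = 0` and all kernel polars
vanish at `w₀`: a SINGULAR direction, non-zero unless `q ≡ 0` on `K` (then `h₂ = 3`). With p533887 /
p536239: `w₀` is an infinitely-near double point with corank-two successor, and it is the ONLY one.

WHAT IS PROVED (every `n`; (1) over every field of characteristic `2`, (2) over perfect ones):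

* `hypersurface_exists_null_polar_of_two_le_milnorHilbertTwo` — `e = 2`, `h₂ ≥ 2` ⇒ ∃ `λ₀ ≠ 0` in the
  kernel with all its polars zero on the kernel;
* `hypersurface_exists_satellite_of_milnorHilbertTwo_eq_two` — PERFECT field, `e = 2`, `h₂ = 2` ⇒ ∃ a
  non-zero SINGULAR direction `w₀` of the kernel cubic; `hypersurface_satellite_step_of_milnorHilbertTwo_eq_two`
  — (isolated state) its chart gives a double successor of corank two, isolated with smaller `μ`.

References: [CasasAlvero2000] §3 (satellite points: context); [GreuelPfister2026] (context);
[Hironaka2017] Th. 16.6 p.84 — role replaced only, under adjudication.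
-/

noncomputable section

-- single-problem summit: the doubled namespace component `ResolutionOfSingularities` is forced
set_option linter.dupNamespace false

open scoped BigOperators Classical

open MvPowerSeries IsLocalRing

open Literature.AlgebraicGeometry.Resolution

namespace Summit.ResolutionOfSingularities.ResolutionOfSingularities.Theorems

namespace CampaignW46.HypersurfacesCharTwo

open WildCones WildCones.MuDropCharTwoOrdP ThreefoldsCharTwo

variable {κ : Type} [Field κ] {n : ℕ}

/-! ## A null polar exists when `h₂ ≥ 2` -/

/-- [OURS · L1 W4.6] **If the polar map is injective on the kernel, the six classes span a space of
dimension `≤ 4`.** Corank-two double state; `x, y` the linear generators of `𝔪` modulo `(∂a)+𝔪²`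
(p529758); hypothesis: every kernel vector whose polars vanish on the kernel is zero. Then
`dim κ⟦u⟧/((∂a)+𝔪³) ≤ 4`. [folklore] -/
theorem jetThreeColength_le_four_of_polar_injective [CharP κ 2] {c : (Fin n → ℕ) → κ} (hM : MultP 2 n κ c)
    (he : milnorEmbDim 2 n κ c = 2)
    (hN : ∀ lam : Fin n → κ, Matrix.vecMul lam (polarMatrix (ser 2 n κ c)) = 0 →
      (∀ v : Fin n → κ, Matrix.vecMul v (polarMatrix (ser 2 n κ c)) = 0 →
        ∑ s, lam s * degForm 2 (MvPowerSeries.pderiv s (ser 2 n κ c)) v = 0) → lam = 0) :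
    jetThreeColength (ser 2 n κ c) ≤ 4 := by
  set f := ser 2 n κ c with hfdef
  have hord : 2 ≤ f.order := two_le_order_ser hM
  have hf' := ((FormalCoordChange.two_le_order_iff f).mp hord).2
  have h3 : jetTwoColength f = 3 := by
    have h := (milnorEmbDim_le_and_mod_two hM).2.2
    rw [← hfdef] at h; rw [h, he]
  set J := Ideal.span (Set.range fun s => MvPowerSeries.pderiv s f) with hJ
  set I3 := J ⊔ maximalIdeal (MvPowerSeries (Fin n) κ) ^ 3 with hI3
  have hr := milnorHilbertTwo_range hM he
  have hfr3 : Module.finrank κ (MvPowerSeries (Fin n) κ ⧸ I3) = milnorHilbertTwo 2 n κ c + 3 := hr.2.2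
  haveI : Module.Finite κ (MvPowerSeries (Fin n) κ ⧸ I3) := Module.finite_of_finrank_pos (by omega)
  obtain ⟨a, b, hgen⟩ := exists_linear_pair_of_jetTwoColength_eq_three hf' h3
  set x : MvPowerSeries (Fin n) κ := ∑ s, C (a s) * X s with hx
  set y : MvPowerSeries (Fin n) κ := ∑ s, C (b s) * X s with hy
  have hxm : x ∈ maximalIdeal (MvPowerSeries (Fin n) κ) := sum_C_mul_X_mem_maximalIdeal a
  have hym : y ∈ maximalIdeal (MvPowerSeries (Fin n) κ) := sum_C_mul_X_mem_maximalIdeal b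
  -- a kernel basis `k₁, k₂`
  have hK2 : Module.finrank κ (LinearMap.ker (polarMatrix f).mulVecLin) = 2 := by
    rw [finrank_ker_polarMatrix hM, he]
  obtain ⟨k₁, hk₁K, hk₁0⟩ : ∃ k ∈ LinearMap.ker (polarMatrix f).mulVecLin, k ≠ 0 := by
    by_contra h
    push Not at h
    have hbot : LinearMap.ker (polarMatrix f).mulVecLin = ⊥ := (Submodule.eq_bot_iff _).mpr h
    rw [hbot, finrank_bot] at hK2
    omega
  have hk₁ : Matrix.vecMul k₁ (polarMatrix f) = 0 := (mem_ker_polarMatrix_iff _ _).mp hk₁K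
  obtain ⟨k₂, hk₂, hnot, hspan⟩ := exists_kernel_pair hM he hk₁0 hk₁
  -- the two relations
  set D : (Fin n → κ) → MvPowerSeries (Fin n) κ := fun k => ∑ l, C (k l) * MvPowerSeries.pderiv l f with hDdef
  have hDJ : ∀ k, D k ∈ J := fun k => sum_C_mul_pderiv_mem_jac f k
  have hD2 : ∀ k, Matrix.vecMul k (polarMatrix f) = 0 → D k ∈ maximalIdeal (MvPowerSeries (Fin n) κ) ^ 2 :=
    fun k hk => sum_C_mul_pderiv_mem_maximalIdeal_sq hord hk
  obtain ⟨α₁, β₁, γ₁, h₁⟩ := exists_quadratic_coeffs hxm hym hgen (hD2 k₁ hk₁)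
  obtain ⟨α₂, β₂, γ₂, h₂⟩ := exists_quadratic_coeffs hxm hym hgen (hD2 k₂ hk₂)
  -- the quadratic classes and the linear map `κ³ → Q₃`
  set q : Fin 3 → MvPowerSeries (Fin n) κ ⧸ I3 :=
    ![Ideal.Quotient.mk I3 (x ^ 2), Ideal.Quotient.mk I3 (x * y), Ideal.Quotient.mk I3 (y ^ 2)] with hq
  set L := Fintype.linearCombination κ q with hL
  have hLapply : ∀ g : Fin 3 → κ, L g = Ideal.Quotient.mk I3 (C (g 0) * x ^ 2 + C (g 1) * (x * y) + C (g 2) * y ^ 2) := by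
    intro g
    rw [hL, Fintype.linearCombination_apply, Fin.sum_univ_three]
    simp only [hq, Matrix.cons_val_zero, Matrix.cons_val_one, Matrix.cons_val, map_add, mk_C_mul]
  -- the relation vectors lie in the kernel of `L`
  have hrel : ∀ (k : Fin n → κ) (α β γ : κ),
      D k - (C α * x ^ 2 + C β * (x * y) + C γ * y ^ 2) ∈
        maximalIdeal (MvPowerSeries (Fin n) κ) * J ⊔ maximalIdeal (MvPowerSeries (Fin n) κ) ^ 3 →
      L ![α, β, γ] = 0 := by
    intro k α β γ hk
    rw [hLapply]
    simp only [Matrix.cons_val_zero, Matrix.cons_val_one, Matrix.cons_val]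
    refine Ideal.Quotient.eq_zero_iff_mem.mpr ?_
    have h := Ideal.sub_mem _ (Ideal.mem_sup_left (hDJ k) : D k ∈ I3) (maximalIdeal_mul_jac_sup_le f hk)
    rwa [sub_sub_cancel] at h
  -- independence of the two relation vectors
  have hindep : LinearIndependent κ ![(![α₁, β₁, γ₁] : Fin 3 → κ), ![α₂, β₂, γ₂]] := by
    refine LinearIndependent.pair_iff.mpr fun s t hst => ?_
    -- `s D k₁ + t D k₂ = D (s k₁ + t k₂)` lies in `𝔪J + 𝔪³`
    have hlin : D (s • k₁ + t • k₂) = C s * D k₁ + C t * D k₂ := by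
      simp only [hDdef, Finset.mul_sum, ← Finset.sum_add_distrib]
      refine Finset.sum_congr rfl fun l _ => ?_
      rw [Pi.add_apply, Pi.smul_apply, Pi.smul_apply, smul_eq_mul, smul_eq_mul, map_add, map_mul, map_mul]
      ring
    have hmem : D (s • k₁ + t • k₂) ∈
        maximalIdeal (MvPowerSeries (Fin n) κ) * J ⊔ maximalIdeal (MvPowerSeries (Fin n) κ) ^ 3 := by
      have hcomb := Ideal.add_mem _ (Ideal.mul_mem_left _ (C s) h₁) (Ideal.mul_mem_left _ (C t) h₂)
      have hzero : C s * (C α₁ * x ^ 2 + C β₁ * (x * y) + C γ₁ * y ^ 2) +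
          C t * (C α₂ * x ^ 2 + C β₂ * (x * y) + C γ₂ * y ^ 2) = 0 := by
        have e0 := congrFun hst 0
        have e1 := congrFun hst 1
        have e2 := congrFun hst 2
        simp only [Pi.add_apply, Pi.smul_apply, smul_eq_mul, Matrix.cons_val_zero, Matrix.cons_val_one,
          Matrix.cons_val, Pi.zero_apply] at e0 e1 e2
        have : C s * (C α₁ * x ^ 2 + C β₁ * (x * y) + C γ₁ * y ^ 2) +
            C t * (C α₂ * x ^ 2 + C β₂ * (x * y) + C γ₂ * y ^ 2) =
            C (s * α₁ + t * α₂) * x ^ 2 + C (s * β₁ + t * β₂) * (x * y) + C (s * γ₁ + t * γ₂) * y ^ 2 := by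
          simp only [map_add, map_mul]; ring
        rw [this, e0, e1, e2, map_zero, zero_mul, zero_mul, zero_mul, add_zero, add_zero]
      have h' : C s * D k₁ + C t * D k₂ = C s * (D k₁ - (C α₁ * x ^ 2 + C β₁ * (x * y) + C γ₁ * y ^ 2)) +
          C t * (D k₂ - (C α₂ * x ^ 2 + C β₂ * (x * y) + C γ₂ * y ^ 2)) := by
        rw [mul_sub, mul_sub, sub_add_sub_comm, hzero, sub_zero]
      rw [hlin, h']
      exact hcomb
    -- so its polars vanish on the kernel, hence `s k₁ + t k₂ = 0`
    have hK : Matrix.vecMul (s • k₁ + t • k₂) (polarMatrix f) = 0 := by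
      rw [Matrix.add_vecMul, Matrix.smul_vecMul, Matrix.smul_vecMul, hk₁, hk₂, smul_zero, smul_zero, add_zero]
    have hzero := hN _ hK fun v hv => by
      have hv' : ∀ s, degForm 1 (MvPowerSeries.pderiv s f) v = 0 := fun s => by
        rw [degForm_one_pderiv_eq_vecMul, hv, Pi.zero_apply]
      rw [← degForm_two_sum_C_mul_pderiv]
      exact degForm_two_eq_zero_of_mem_maximalIdeal_mul_jac hf' hv' hmem
    have ht : t = 0 := by
      by_contra ht
      apply hnot (-(t⁻¹ * s))
      have := congrArg (fun z => t⁻¹ • z) hzero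
      simp only [smul_add, smul_smul, inv_mul_cancel₀ ht, one_smul, smul_zero] at this
      rw [neg_smul, eq_neg_iff_add_eq_zero, add_comm]
      exact this
    rw [ht, zero_smul, add_zero] at hzero
    have hs : s = 0 := by
      by_contra hs
      exact hk₁0 (by simpa [hs] using hzero)
    exact ⟨hs, ht⟩
  -- the kernel of `L` has dimension `≥ 2`
  have hc₁ : (![α₁, β₁, γ₁] : Fin 3 → κ) ∈ LinearMap.ker L := LinearMap.mem_ker.mpr (hrel k₁ α₁ β₁ γ₁ h₁)
  have hc₂ : (![α₂, β₂, γ₂] : Fin 3 → κ) ∈ LinearMap.ker L := LinearMap.mem_ker.mpr (hrel k₂ α₂ β₂ γ₂ h₂)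
  have hker : 2 ≤ Module.finrank κ (LinearMap.ker L) := by
    set u : Fin 2 → LinearMap.ker L := ![⟨_, hc₁⟩, ⟨_, hc₂⟩] with hu
    have hu' : (LinearMap.ker L).subtype ∘ u = ![(![α₁, β₁, γ₁] : Fin 3 → κ), ![α₂, β₂, γ₂]] := by
      funext i
      fin_cases i <;> rfl
    have hli : LinearIndependent κ u :=
      LinearIndependent.of_comp (LinearMap.ker L).subtype (by rw [hu']; exact hindep)
    have h := hli.fintype_card_le_finrank
    rwa [Fintype.card_fin] at h
  have hrange : Module.finrank κ (LinearMap.range L) ≤ 1 := by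
    have h := LinearMap.finrank_range_add_finrank_ker L
    rw [Module.finrank_fin_fun] at h
    omega
  -- the span of the first three classes, and everything is in `S₁ ⊔ range L`
  set S₁ := Submodule.span κ (Set.range
    ![Ideal.Quotient.mk I3 1, Ideal.Quotient.mk I3 x, Ideal.Quotient.mk I3 y]) with hS₁def
  have hS₁ : Module.finrank κ S₁ ≤ 3 := finrank_range_le_card _
  have hLsingle : ∀ i : Fin 3, q i ∈ LinearMap.range L := fun i =>
    ⟨Pi.single i 1, by rw [hL, Fintype.linearCombination_apply_single, one_smul]⟩
  have htop : (⊤ : Submodule κ (MvPowerSeries (Fin n) κ ⧸ I3)) ≤ S₁ ⊔ LinearMap.range L := by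
    refine (top_le_span_six hxm hym hgen).trans (Submodule.span_le.mpr ?_)
    rintro _ ⟨i, rfl⟩
    fin_cases i
    · exact Submodule.mem_sup_left (Submodule.subset_span ⟨0, rfl⟩)
    · exact Submodule.mem_sup_left (Submodule.subset_span ⟨1, rfl⟩)
    · exact Submodule.mem_sup_left (Submodule.subset_span ⟨2, rfl⟩)
    · exact Submodule.mem_sup_right (hLsingle 0)
    · exact Submodule.mem_sup_right (hLsingle 1)
    · exact Submodule.mem_sup_right (hLsingle 2)
  have h1 := Submodule.finrank_mono htop
  rw [finrank_top] at h1
  have h2 := Submodule.finrank_add_le_finrank_add_finrank S₁ (LinearMap.range L)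
  have hfin : Module.finrank κ (MvPowerSeries (Fin n) κ ⧸ I3) ≤ 4 := by omega
  exact hfin

/-- [OURS · L1 W4.6 rung (ii) at `p = 2`, every dimension; NOT a statement of the manuscript] **`h₂ ≥ 2`
⇒ A NULL POLAR EXISTS**: for a double state with `e(c) = 2` and `h₂(c) ≥ 2` there is a NON-ZERO kernel
vector `λ₀` of the polar form all of whose polars `v ↦ Σₛ λ₀ₛ (∂ₛa)₂(v)` vanish on the kernel (if none
existed, `dim κ⟦u⟧/((∂a)+𝔪³) ≤ 4`, i.e. `h₂ ≤ 1`). [folklore] -/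
theorem hypersurface_exists_null_polar_of_two_le_milnorHilbertTwo [CharP κ 2] (c : (Fin n → ℕ) → κ)
    (hM : MultP 2 n κ c) (he : milnorEmbDim 2 n κ c = 2) (hh : 2 ≤ milnorHilbertTwo 2 n κ c) :
    ∃ lam : Fin n → κ, lam ≠ 0 ∧ Matrix.vecMul lam (polarMatrix (ser 2 n κ c)) = 0 ∧
      ∀ v : Fin n → κ, Matrix.vecMul v (polarMatrix (ser 2 n κ c)) = 0 →
        ∑ s, lam s * degForm 2 (MvPowerSeries.pderiv s (ser 2 n κ c)) v = 0 := by
  by_contra h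
  push Not at h
  have h4 := jetThreeColength_le_four_of_polar_injective hM he fun lam hlam hpol => by
    by_contra hne
    obtain ⟨v, hv, hv'⟩ := h lam hne hlam
    exact hv' (hpol v hv)
  have hr := (milnorHilbertTwo_range hM he).2.2
  omega

/-! ## Over a perfect field the satellite exists at `h₂ = 2` -/

/-- [OURS · L1 W4.6] Square roots in a perfect field of characteristic two. [folklore] -/
theorem exists_sq_eq [CharP κ 2] [PerfectField κ] (p : κ) : ∃ x : κ, x ^ 2 = p := by
  obtain ⟨x, hx⟩ := surjective_frobenius κ 2 p
  exact ⟨x, by rw [← frobenius_def]; exact hx⟩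

/-- [OURS · L1 W4.6] Characteristic two: the cross term `Σₛ λₛ (∂ₛ D_μ a)₁(μ)` vanishes (symmetry in the
last two slots and `T(μ, μ, ·) = 0`, p536239). [folklore] -/
theorem polarCross_mixed_eq_zero [CharP κ 2] (f : MvPowerSeries (Fin n) κ) (lam μ : Fin n → κ) :
    ∑ s, lam s * degForm 1 (MvPowerSeries.pderiv s (∑ l, C (μ l) * MvPowerSeries.pderiv l f)) μ = 0 := by
  rw [polarCross_symm, polarCross_self_eq_zero]

/-- [OURS · L1 W4.6 rung (ii) at `p = 2`, every dimension, PERFECT field; NOT a statement of the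
manuscript] **AT `h₂ = 2` THE SATELLITE DIRECTION EXISTS**: for a double state of `z² = a(u₁,…,uₙ)` over a
perfect field of characteristic `2` with `e(c) = 2`, `h₂(c) = 2`, there is a NON-ZERO kernel vector `w₀`
which is a SINGULAR point of the tangent cubic on the kernel plane (all kernel polars vanish at `w₀`).
(`λ₀` with null polar from `h₂ ≥ 2`; complete to `K = ⟨λ₀, μ⟩`; the polar of `μ` is additive on `K`,
`q(sλ₀ + tμ) = s²q(λ₀) + t²q(μ)`; with square roots `p'² = q(λ₀)`, `r'² = q(μ)`: `w₀ = r'λ₀ + p'μ`,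
`q(w₀) = 2 q(λ₀)q(μ) = 0`; `w₀ = 0` would force `q ≡ 0` on `K`, i.e. `h₂ = 3`.) By p536239 it is the
UNIQUE satellite direction. [folklore] -/
theorem hypersurface_exists_satellite_of_milnorHilbertTwo_eq_two [CharP κ 2] [PerfectField κ]
    (c : (Fin n → ℕ) → κ) (hM : MultP 2 n κ c) (he : milnorEmbDim 2 n κ c = 2)
    (hh : milnorHilbertTwo 2 n κ c = 2) :
    ∃ w₀ : Fin n → κ, w₀ ≠ 0 ∧ Matrix.vecMul w₀ (polarMatrix (ser 2 n κ c)) = 0 ∧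
      ∀ v : Fin n → κ, Matrix.vecMul v (polarMatrix (ser 2 n κ c)) = 0 →
        ∑ l, v l * degForm 2 (MvPowerSeries.pderiv l (ser 2 n κ c)) w₀ = 0 := by
  set f := ser 2 n κ c with hfdef
  obtain ⟨lam, hlam0, hlamK, hnull⟩ := hypersurface_exists_null_polar_of_two_le_milnorHilbertTwo c hM he (by omega)
  obtain ⟨μ, hμK, hnot, hspan⟩ := exists_kernel_pair hM he hlam0 hlamK
  -- the additive quadratic form `q = polar(μ, ·)`
  set Dμ : MvPowerSeries (Fin n) κ := ∑ l, C (μ l) * MvPowerSeries.pderiv l f with hDμ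
  have hq : ∀ v : Fin n → κ, degForm 2 Dμ v = ∑ l, μ l * degForm 2 (MvPowerSeries.pderiv l f) v :=
    fun v => degForm_two_sum_C_mul_pderiv f μ v
  obtain ⟨p', hp'⟩ := exists_sq_eq (degForm 2 Dμ lam)
  obtain ⟨r', hr'⟩ := exists_sq_eq (degForm 2 Dμ μ)
  set w₀ : Fin n → κ := r' • lam + p' • μ with hw₀
  -- `q(w₀) = 0`
  have hqw₀ : degForm 2 Dμ w₀ = 0 := by
    have hcross : ∑ s, (r' • lam) s * degForm 1 (MvPowerSeries.pderiv s Dμ) (p' • μ) = 0 := by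
      have h : ∑ s, (r' • lam) s * degForm 1 (MvPowerSeries.pderiv s Dμ) (p' • μ) =
          r' * p' * ∑ s, lam s * degForm 1 (MvPowerSeries.pderiv s Dμ) μ := by
        rw [Finset.mul_sum]
        refine Finset.sum_congr rfl fun s _ => ?_
        rw [Pi.smul_apply, smul_eq_mul, degForm_smul_vec, pow_one]
        ring
      rw [h, hDμ, polarCross_mixed_eq_zero, mul_zero]
    rw [hw₀, degForm_two_add, hcross, add_zero, degForm_smul_vec, degForm_smul_vec, ← hp', ← hr']
    rw [show r' ^ 2 * p' ^ 2 + p' ^ 2 * r' ^ 2 = r' ^ 2 * p' ^ 2 + r' ^ 2 * p' ^ 2 by ring]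
    exact CharTwo.add_self_eq_zero _
  -- `w₀ ≠ 0`: otherwise `p' = r' = 0`, `q` vanishes at `λ₀` and `μ`, hence on `K`, and `h₂ = 3`
  have hw₀0 : w₀ ≠ 0 := by
    intro h0
    have hpr : p' = 0 ∧ r' = 0 := by
      by_contra hne
      rw [not_and_or] at hne
      rcases hne with hp | hr
      · apply hnot (-(p'⁻¹ * r'))
        have h := congrArg (fun z => p'⁻¹ • z) h0
        simp only [hw₀, smul_add, smul_smul, inv_mul_cancel₀ hp, one_smul, smul_zero] at h
        rw [neg_smul, eq_neg_iff_add_eq_zero, add_comm]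
        exact h
      · apply hlam0
        have h := congrArg (fun z => r'⁻¹ • z) h0
        simp only [hw₀, smul_add, smul_smul, inv_mul_cancel₀ hr, one_smul, smul_zero] at h
        by_cases hp : p' = 0
        · rw [hp, mul_zero, zero_smul, add_zero] at h
          exact h
        · exfalso
          apply hnot (-((r'⁻¹ * p')⁻¹))
          have h' := congrArg (fun z => (r'⁻¹ * p')⁻¹ • z) h
          have hne : r'⁻¹ * p' ≠ 0 := mul_ne_zero (inv_ne_zero hr) hp
          simp only [smul_add, smul_smul, inv_mul_cancel₀ hne, one_smul, smul_zero] at h'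
          rw [neg_smul, eq_neg_iff_add_eq_zero, add_comm]
          exact h'
    obtain ⟨hp0, hr0⟩ := hpr
    have hqlam : degForm 2 Dμ lam = 0 := by rw [← hp', hp0]; ring
    have hqμ : degForm 2 Dμ μ = 0 := by rw [← hr', hr0]; ring
    -- all polars vanish on `K`
    have hall : ∀ a v : Fin n → κ, Matrix.vecMul a (polarMatrix f) = 0 → Matrix.vecMul v (polarMatrix f) = 0 →
        ∑ s, a s * degForm 2 (MvPowerSeries.pderiv s f) v = 0 := by
      intro a v ha hv
      obtain ⟨α, β, hαβ⟩ := hspan a ha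
      obtain ⟨σ, ρ, hσρ⟩ := hspan v hv
      -- polar(a, v) = α polar(λ₀, v) + β polar(μ, v) = β q(v); q(v) = σ² q(λ₀) + ρ² q(μ) + cross = 0
      have hqv : degForm 2 Dμ v = 0 := by
        have hcross : ∑ s, (σ • lam) s * degForm 1 (MvPowerSeries.pderiv s Dμ) (ρ • μ) = 0 := by
          have h : ∑ s, (σ • lam) s * degForm 1 (MvPowerSeries.pderiv s Dμ) (ρ • μ) =
              σ * ρ * ∑ s, lam s * degForm 1 (MvPowerSeries.pderiv s Dμ) μ := by
            rw [Finset.mul_sum]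
            refine Finset.sum_congr rfl fun s _ => ?_
            rw [Pi.smul_apply, smul_eq_mul, degForm_smul_vec, pow_one]
            ring
          rw [h, hDμ, polarCross_mixed_eq_zero, mul_zero]
        rw [← hσρ, degForm_two_add, hcross, add_zero, degForm_smul_vec, degForm_smul_vec, hqlam, hqμ,
          mul_zero, mul_zero, add_zero]
      rw [← hαβ]
      have hsplit : ∑ s, (α • lam + β • μ) s * degForm 2 (MvPowerSeries.pderiv s f) v =
          α * ∑ s, lam s * degForm 2 (MvPowerSeries.pderiv s f) v +
            β * ∑ s, μ s * degForm 2 (MvPowerSeries.pderiv s f) v := by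
        rw [Finset.mul_sum, Finset.mul_sum, ← Finset.sum_add_distrib]
        refine Finset.sum_congr rfl fun s _ => ?_
        simp only [Pi.add_apply, Pi.smul_apply, smul_eq_mul]
        ring
      rw [hsplit, hnull v hv, ← hq v, hqv, mul_zero, mul_zero, add_zero]
    have h3 := hypersurface_milnorHilbertTwo_eq_three_of_polar_eq_zero c hM he hall
    omega
  have hw₀K : Matrix.vecMul w₀ (polarMatrix f) = 0 := by
    rw [hw₀, Matrix.add_vecMul, Matrix.smul_vecMul, Matrix.smul_vecMul, hlamK, hμK, smul_zero, smul_zero, add_zero]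
  refine ⟨w₀, hw₀0, hw₀K, fun v hv => ?_⟩
  obtain ⟨α, β, hαβ⟩ := hspan v hv
  rw [← hαβ]
  have hsplit : ∑ s, (α • lam + β • μ) s * degForm 2 (MvPowerSeries.pderiv s f) w₀ =
      α * ∑ s, lam s * degForm 2 (MvPowerSeries.pderiv s f) w₀ +
        β * ∑ s, μ s * degForm 2 (MvPowerSeries.pderiv s f) w₀ := by
    rw [Finset.mul_sum, Finset.mul_sum, ← Finset.sum_add_distrib]
    refine Finset.sum_congr rfl fun s _ => ?_
    simp only [Pi.add_apply, Pi.smul_apply, smul_eq_mul]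
    ring
  rw [hsplit, hnull w₀ hw₀K, ← hq w₀, hqw₀, mul_zero, mul_zero, add_zero]

/-- [OURS · L1 W4.6 rung (ii) at `p = 2`, every dimension, PERFECT field; NOT a statement of the
manuscript] **THE `(2,2)` CLASS CONTINUES THE CORANK-TWO CHAIN AT EXACTLY ONE POINT**: for an isolated
double state over a perfect field of characteristic `2` with `e(c) = 2`, `h₂(c) = 2`, there is a chart
`i` and a translation at which the successor is a double point of corank `2`, ISOLATED with smaller
Milnor number (the satellite, p533887 and gen 4's isolatedness transfer); by p536239 any other near point
is free. [folklore] -/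
theorem hypersurface_satellite_step_of_milnorHilbertTwo_eq_two [CharP κ 2] [PerfectField κ]
    (c : (Fin n → ℕ) → κ) (hM : MultP 2 n κ c) (hI : Isol 2 n κ c) (he : milnorEmbDim 2 n κ c = 2)
    (hh : milnorHilbertTwo 2 n κ c = 2) :
    ∃ (i : Fin n) (τ : Fin n → κ), MultP 2 n κ (step 2 n κ i τ c) ∧
      milnorEmbDim 2 n κ (step 2 n κ i τ c) = 2 ∧ Isol 2 n κ (step 2 n κ i τ c) ∧
      mu 2 n κ (step 2 n κ i τ c) < mu 2 n κ c := by
  obtain ⟨w₀, hw₀0, hw₀K, hsing⟩ := hypersurface_exists_satellite_of_milnorHilbertTwo_eq_two c hM he hh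
  obtain ⟨i, hi⟩ : ∃ i, w₀ i ≠ 0 := by
    by_contra h
    push Not at h
    exact hw₀0 (funext h)
  obtain ⟨hM', he'⟩ := hypersurface_singular_direction_corank_two c hM hI he hi hw₀K hsing
  obtain ⟨hI', hμ⟩ := hypersurface_isol_step_of_milnorHilbertTwo_le_two c i _ hM hI he (by omega) hM'
  exact ⟨i, _, hM', he', hI', hμ⟩

end CampaignW46.HypersurfacesCharTwo

end Summit.ResolutionOfSingularities.ResolutionOfSingularities.Theorems

end
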